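import Summits.Ventures.QEC.Census.CertCheckBZ
import HarnessLib

/-!
# Lane-parallel (bit-sliced) replay of a Brouwer–Zimmermann enumeration matrix — definitions
# (method `bz` / `bz_aut`, check C4 of plan/CERT-FORMAT.md v1.1 §5.3; a KERNEL-speed twin of the `scan` replay)

The C4 replay of one enumeration matrix `G` (rows `G[0..k)`, words below `2^n`) must visit every selection
`u` with `1 ≤ |u| ≤ t` and check the leaf `bzLeaf wmax allow u (u·G)` ("weight `> wmax` or allow-listed").
`Census/CertCheckBZ.lean` does this one selection at a time (`scan`); in the kernel that costs ≈ 10²–10³ µs per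
selection because every reduction step is expensive and each visits ONE 144-bit word.

This file evaluates the SAME leaves with every kernel step acting on ALL selections of a LANE FAMILY at once:
* a lane family is `(N, χ)`: `N` lanes and one indicator word `χ_j` per row `j` — bit `b` of `χ_j` says "row `j`
  belongs to the selection of lane `b`". `segment t m₀ s` is the family of all selections `S ∪ {m}`,
  `S ⊆ [0,m)`, `|S| ≤ t − 1`, for `m ∈ [m₀, m₀+s)` (built from the colex/Pascal recursion `triStep` with
  `Nat.lor` / `Nat.shiftLeft` only);
* the PLANE of column `q` is `⊕_{j : bit q of G[j]} χ_j` — its bit `b` is coordinate `q` of the codeword of lane `b`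
  (`planeAcc`);
* a unary THRESHOLD COUNTER `U_i ← U_i ||| (U_{i−1} &&& P)` over the planes of the columns `cols` leaves in `U_θ`
  exactly the lanes whose codeword has `≥ θ` set bits among `cols` (`cAdd`, `countCols`);
* the lanes below threshold ("stragglers", for a valid certificate: the allow-listed stabilizers) are decoded from
  the `χ` bits and re-checked ONE BY ONE with the tree's own `bzLeaf` (`laneSel`, `laneLeaf`, `failLoop`).
Every hot operation is a raw `Nat.land/lor/xor/shiftLeft/shiftRight/beq/pow/sub` on literals (GMP in the kernel)
and every recursion is structural (`decide +kernel` reduces it; no well-founded recursion).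

MEASURED (farm, `decide +kernel`, axioms `{propext}`, 2026-08-27, qec-type-01 g3): the depth-5 matrix of block 0 of
the `[[144,12,12]]` `bz_aut` certificate (all 15 082 602 selections of ≤ 5 of 72 rows of 144 bits) in 40 s over 9
declarations, the depth-4 matrix (1 091 058 selections) in 11 s in one declaration ≈ 3.8·10⁵ selections/s — about
50× the per-selection kernel shape and faster than `native_decide` on the same matrix; one declaration holds up to
≈ 8·10⁶ lanes (memory).

SOUNDNESS is the sibling file `Census/CertBZPlaneSound.lean`: passing `segOK` checks for segments covering
`[0, |G|)` give `Reaches (bzLeaf wmax allow) (rowPos G 0) t 0 0`, hence `matrixEnumOK … = true`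
(`Census/CertBZChunks.lean: matrixEnumOK_of_reaches`) — the tree's own statement; nothing here restates or weakens
a check, and no distance value is asserted. Definitions only in this file (plus `rfl`/small sanity lemmas).
-/

set_option autoImplicit false

namespace Summit.Ventures.QEC.Census.Plane

/-! ## Words -/

/-- The all-ones word of `N` bits, `2^N − 1` (raw primitives). (definition) -/
def ones (N : ℕ) : ℕ := Nat.sub (Nat.pow 2 N) 1

/-- Bit `b` of `x`, `((x >>> b) &&& 1) == 1` (raw primitives; `= x.testBit b`, see the soundness file). (definition) -/
def bitAt (x b : ℕ) : Bool := Nat.beq (Nat.land (Nat.shiftRight x b) 1) 1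

/-- Shift every entry of a word list: `b_j <<< N`. (definition) -/
def shiftAll (N : ℕ) : List ℕ → List ℕ
  | [] => []
  | b :: bs => Nat.shiftLeft b N :: shiftAll N bs

/-- Lane concatenation of two indicator lists: `a_j ||| (b_j <<< N)`, missing entries read as `0` (the lanes of the
second family are placed after the `N` lanes of the first). Structural on the first list. (definition) -/
def zipLorShift (N : ℕ) : List ℕ → List ℕ → List ℕ
  | [], bs => shiftAll N bs
  | a :: as, [] => a :: zipLorShift N as []
  | a :: as, b :: bs => Nat.lor a (Nat.shiftLeft b N) :: zipLorShift N as bs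

/-! ## The colex triangle of indicator words -/

/-- One level of the `m ↦ m+1` step: the `w`-subsets of `[0,m+1)` are the `w`-subsets of `[0,m)` (lanes kept), then
the `(w−1)`-subsets of `[0,m)` with `m` added (lanes appended): `χ_j' = χ_j ||| (χ⁻_j <<< N)` for `j < m` and the new
row `χ_m' = ones N⁻ <<< N` (`N`, `χ` = level `w`; `N⁻`, `χ⁻` = level `w − 1`). (definition) -/
def mergeChis (N Np : ℕ) (chis chisp : List ℕ) : List ℕ :=
  zipLorShift N chis chisp ++ [Nat.shiftLeft (ones Np) N]

/-- The `m ↦ m+1` step on all levels (level list `[(N_0, χ^0), (N_1, χ^1), …]`; the level below level `0` is the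
empty family `(0, [])`). (definition) -/
def triStepAux : ℕ → List ℕ → List (ℕ × List ℕ) → List (ℕ × List ℕ)
  | _, _, [] => []
  | Np, chisp, (N, chis) :: rest => (Nat.add N Np, mergeChis N Np chis chisp) :: triStepAux N chis rest

/-- The `m ↦ m+1` step of the triangle. (definition) -/
def triStep (levels : List (ℕ × List ℕ)) : List (ℕ × List ℕ) := triStepAux 0 [] levels

/-- The triangle at `m = 0` with levels `0 … L`: level `0` has the one empty selection, the others none. (definition) -/
def triInit (L : ℕ) : List (ℕ × List ℕ) := (1, []) :: List.replicate L (0, [])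

/-- The triangle of the prefix `[0,m)`: level `w` is `(C(m,w), [χ_0, …, χ_{m−1}])`, lane `b` of level `w` = the
`b`-th `w`-subset of `[0,m)` in colex order. (definition, structural on `m`) -/
def triAt : ℕ → ℕ → List (ℕ × List ℕ)
  | 0, L => triInit L
  | m + 1, L => triStep (triAt m L)

/-! ## Blocks and segments -/

/-- Concatenate the levels of a triangle into one family: `(Σ_w N_w, [χ_0, …])`. (definition) -/
def catLevels : List (ℕ × List ℕ) → ℕ × List ℕ
  | [] => (0, [])
  | (N, chis) :: rest => (Nat.add N (catLevels rest).1, zipLorShift N chis (catLevels rest).2)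

/-- The block of `m`: every lane of the concatenated levels (a subset `S ⊆ [0,m)`) with row `m` ADDED
(`χ_m = ones`): the selections `S ∪ {m}`. The triangle's `χ` lists have length `m`. (definition) -/
def blockOf (tri : List (ℕ × List ℕ)) : ℕ × List ℕ :=
  ((catLevels tri).1, (catLevels tri).2 ++ [ones (catLevels tri).1])

/-- Segment accumulation: append the blocks of `m, m+1, …, m+s−1` (triangle carried along) to `acc`. (definition) -/
def segAcc : ℕ → ℕ → List (ℕ × List ℕ) → ℕ × List ℕ → ℕ × List ℕ
  | _, 0, _, acc => acc
  | m, s + 1, tri, acc =>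
    segAcc (m + 1) s (triStep tri) (Nat.add acc.1 (blockOf tri).1, zipLorShift acc.1 acc.2 (blockOf tri).2)

/-- **The lane family of a segment**: all selections `S ∪ {m}` with `m ∈ [m₀, m₀+s)`, `S ⊆ [0,m)`, `|S| ≤ t − 1` —
i.e. every selection of size `1 … t` whose largest row index lies in the segment. (definition) -/
def segment (t m0 s : ℕ) : ℕ × List ℕ := segAcc m0 s (triAt m0 (t - 1)) (0, [])

/-! ## Planes and the threshold counter -/

/-- The plane of column `q`, accumulated from `acc`: `acc ⊕ ⊕_{j : bit q of G[j] set} χ_j` (rows and indicator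
words zipped; stops at the shorter list). (definition) -/
def planeAcc (q : ℕ) : List ℕ → List ℕ → ℕ → ℕ
  | g :: gs, c :: cs, acc => planeAcc q gs cs (cond (bitAt g q) (Nat.xor acc c) acc)
  | _, _, acc => acc

/-- Unary threshold counter update by a plane `P` on the levels `[U_i, U_{i+1}, …]`, given `c = U_{i−1} &&& P`:
`U_i' = U_i ||| c`, then continue with `c' = U_i &&& P`. (definition) -/
def cAdd (P : ℕ) : ℕ → List ℕ → List ℕ
  | _, [] => []
  | c, U :: Us => Nat.lor U c :: cAdd P (Nat.land U P) Us

/-- Counter update by a plane from level `1` (`U_0 = 𝟙`, so `c = P`). (definition) -/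
def cAddP (P : ℕ) (Us : List ℕ) : List ℕ := cAdd P P Us

/-- Fold the columns `cols`: build each plane and feed it to the counter `Us`. (definition) -/
def countCols (G chis : List ℕ) : List ℕ → List ℕ → List ℕ
  | [], Us => Us
  | q :: qs, Us => countCols G chis qs (cAddP (planeAcc q G chis 0) Us)

/-- Last entry of a word list (default `d`): `lastD [x₁, …, x_k] d = x_k`. (definition) -/
def lastD : List ℕ → ℕ → ℕ
  | [], d => d
  | x :: xs, _ => lastD xs x

/-! ## Stragglers: decode a lane and re-check it with `bzLeaf` -/

/-- Some set-bit position of `F ≠ 0` (binary search for the highest set bit over `k` doubling levels; exact for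
`F < 2^(2^k)`; soundness never depends on which bit is returned). (definition) -/
def hiBit : ℕ → ℕ → ℕ
  | 0, _ => 0
  | k + 1, F =>
    cond (Nat.beq (Nat.shiftRight F (Nat.pow 2 k)) 0) (hiBit k F)
      (Nat.add (Nat.pow 2 k) (hiBit k (Nat.shiftRight F (Nat.pow 2 k))))

/-- Decode lane `b`: walk the rows `j = j₀, j₀+1, …` with their indicator words and accumulate the selection word
`u ⊕= 2^j` and the codeword `c ⊕= G[j]` over the member rows. (definition) -/
def laneSel (b : ℕ) : List ℕ → List ℕ → ℕ → ℕ → ℕ → ℕ × ℕ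
  | g :: gs, x :: xs, j, u, c =>
    cond (bitAt x b) (laneSel b gs xs (j + 1) (Nat.xor u (Nat.pow 2 j)) (Nat.xor c g)) (laneSel b gs xs (j + 1) u c)
  | _, _, _, u, c => (u, c)

/-- The leaf of lane `b`: the tree's `bzLeaf` at the decoded (selection word, codeword). (definition) -/
def laneLeaf (wmax : ℕ) (allow G chis : List ℕ) (b : ℕ) : Bool :=
  bzLeaf wmax allow (laneSel b G chis 0 0 0).1 (laneSel b G chis 0 0 0).2

/-- Re-check every set bit (lane) of the straggler mask `F`, at most `fuel` of them; `false` if bits remain.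
(definition, structural on `fuel`) -/
def failLoop (wmax : ℕ) (allow G chis : List ℕ) : ℕ → ℕ → Bool
  | 0, F => Nat.beq F 0
  | fuel + 1, F =>
    cond (Nat.beq F 0) true
      (laneLeaf wmax allow G chis (hiBit 25 F) &&
        failLoop wmax allow G chis fuel (Nat.xor F (Nat.pow 2 (hiBit 25 F))))

/-! ## The checks -/

/-- **One lane family** `fam = (N, χ)`: count the columns `cols` of every lane's codeword against the threshold `θ`
(`θ` counter levels), then re-check the lanes `b < N` below threshold with `bzLeaf` (`fuel` = how many stragglers are
tolerated, e.g. the allow-list length + 1). (definition) -/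
def familyOK (wmax : ℕ) (cols allow G : List ℕ) (fam : ℕ × List ℕ) (θ fuel : ℕ) : Bool :=
  failLoop wmax allow G fam.2 fuel
    (Nat.xor (ones fam.1) (lastD (countCols G fam.2 cols (List.replicate θ 0)) 0))

/-- **The segment check**: the family of all selections of size `1 … t` with largest row in `[m₀, m₀+s)`, columns
`0 … n−1`, threshold `wmax + 1`. A matrix of `k` rows is replayed by segments covering `[0,k)`
(soundness: `Census/CertBZPlaneSound.lean`). (definition) -/
def segOK (n wmax : ℕ) (allow G : List ℕ) (t m0 s fuel : ℕ) : Bool :=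
  familyOK wmax (List.range n) allow G (segment t m0 s) (wmax + 1) fuel

/-! ## Specification vocabulary (used by the soundness file; never evaluated) -/

/-- Lane `b < N` of the family `fam = (N, χ)` selects exactly the rows listed in `J`. (definition) -/
def Covers (fam : ℕ × List ℕ) (J : List ℕ) : Prop :=
  ∃ b, b < fam.1 ∧ ∀ j, (fam.2.getD j 0).testBit b = decide (j ∈ J)

/-- All indicator words of the family are below `2^N` (so it occupies only its own `N` lanes). (definition) -/
def Bnd (fam : ℕ × List ℕ) : Prop := ∀ j, fam.2.getD j 0 < 2 ^ fam.1

/-- The triangle invariant at prefix `m`: every level `w` is bounded by `2^{N_w}`, has `m` indicator words, and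
covers every strictly increasing `w`-list below `m`. (definition) -/
def TriOK (m : ℕ) (tri : List (ℕ × List ℕ)) : Prop :=
  ∀ w, w < tri.length →
    Bnd (tri.getD w (0, [])) ∧ (tri.getD w (0, [])).2.length = m ∧
      ∀ J : List ℕ, J.Pairwise (· < ·) → (∀ j ∈ J, j < m) → J.length = w → Covers (tri.getD w (0, [])) J

/-- Counter invariant at lane `b`: word `k` of `Us` (counter level `i + k`) has bit `b` iff `i + k ≤ cnt`.
(definition) -/
def CounterInv (b cnt i : ℕ) (Us : List ℕ) : Prop :=
  ∀ k, k < Us.length → (Us.getD k 0).testBit b = decide (i + k ≤ cnt)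

/-- The member rows of lane `b` with their row words, in increasing order from offset `j` — the list form of
what `laneSel` folds. (definition) -/
def laneMem (b : ℕ) : List ℕ → List ℕ → ℕ → List (ℕ × ℕ)
  | g :: gs, x :: xs, j => cond (x.testBit b) ((j, g) :: laneMem b gs xs (j + 1)) (laneMem b gs xs (j + 1))
  | _, _, _ => []

/-! ## Controls (the Steane `bz` certificate of `Census/CertCheckBZ.lean`, 4 rows, depth 1) -/

/-- The rows of the first enumeration matrix of the Steane `Z`-side block. -/
def steaneG : List ℕ :=
  giRows (gbRows certSteane7.HZ rcSteane bzSteane.LZ (bzSteane.sideZ.blocks.getD 0 { W := [], mats := [] }))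
    ((bzSteane.sideZ.blocks.getD 0 { W := [], mats := [] }).mats.getD 0 { T := [], A := [], t := 0 })

/-- Control: the depth-1 replay of the Steane matrix passes as one segment (4 lanes). -/
theorem segOK_steane : segOK 7 2 [] steaneG 1 0 4 1 = true := by decide

/-- Control: with threshold `wmax = 3` (the Steane rows have weight 4… but one codeword of weight ≤ 3 would be
needed to fail) the depth-2 replay FAILS — weight-3/weight-4 words below the raised bar are not allow-listed. -/
theorem segOK_steane_neg : segOK 7 4 [] steaneG 2 0 4 3 = false := by decide

/-- Control: the segment sizes are the binomial sums — `|segment 5 71 1| = Σ_{w ≤ 4} C(71, w)` and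
`|segment 4 0 72| = Σ_{1 ≤ w ≤ 4} C(72, w)`. -/
theorem segment_sizes : (segment 5 71 1).1 = 1031347 ∧ (segment 4 0 72).1 = 1091058 := by
  constructor <;> decide +kernel

end Summit.Ventures.QEC.Census.Plane
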